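import Mathlib
import HarnessLib
import Summits.Ventures.LatticeQCDFlow.Scoring.SingleRunMedianOfBlocksWarm
import Summits.Ventures.LatticeQCDFlow.Exactness.ApproxTrivializingSampler

/-!
# Any independence Metropolis sampler with a log-density-ratio oscillation bound `M` certifies its
# own single-run median-of-blocks error bar, at regeneration rate `e^{−M}` (general state space)

HONEST FRAMING: exact (Metropolis-corrected) sampling algorithms for lattice gauge theory;
figures of merit are autocorrelation/cost numbers at stated couplings and volumes; no
continuum-physics claim.

Venture `LatticeQCDFlow` (cell pub-lqcd), topic `Scoring`; FANOUT row 8 (`s0-cpn-nemc`, GEN-15).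
NEW WORK of the cell, not a published result; no definition is introduced.  The general-state-space
instance of the single-run certificates `Scoring/SingleRunMedianOfBlocks.lean` (cold start) and
`Scoring/SingleRunMedianOfBlocksWarm.lean` (warm start), composed with the tree's
`Exactness.indepMH_exact_doeblin_of_density_ratio` (row 30 / lean-2): for probability laws
`q = ρ · π` with `ρ > 0` measurable and `ρ x ≤ e^{M} ρ y` for all `x, y`, the independence Metropolis
kernel `K = indepMH q (1/ρ)` is EXACT for `π` and obeys Doeblin `K(x, ·) ≥ e^{−M} π`.  This is the
form in which the IMH arms of the cell (rows 3 / 4; any normalizing-flow proposal with a certified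
log-weight oscillation) consume the regeneration chapter.  Nothing is cited as a fact.

## Content (`π`, `q = ρ·π` as above with `M > 0`; `K = indepMH q (1/ρ)`; `|f| ≤ C`, `C' = C + |πf|`,
## `Var_π f = ∫ (f − πf)² dπ`; blocks `j < R` of `N ≥ 1` states at times `j(N+g), …, j(N+g)+N−1`;
## `e := e^{−M}`, `MSE_N = (2/e − 1) Var_π f/N + 16 C'²/(e² N²)`)

* **`indepMH_medianOfBlocks`** — COLD START: for every initial law `μ₀`, if `4 MSE_N ≤ s²` then
  `P_{μ₀}( #{j < R : s ≤ |block mean_j − πf|} ≥ R/2 ) ≤ (R − 1)(1 − e^{−M})^g + e^{−R/8}`;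
* **`indepMH_medianOfBlocks_warm`** — WARM START (`μ₀ = π`): the same bound under the variance-only
  condition `4 (2e^{M} − 1) Var_π f ≤ N s²`.

Reading (value-free): a certified log-weight oscillation `M` of an independence proposal is a complete
single-run error-bar protocol: block length from the block condition, gap `g ≈ e^{M} log(R/η)`,
`R ≈ 8 log(1/η)` blocks, confidence `1 − 2η` for the median of the block means — no acceptance-rate,
variance or autocorrelation measurement enters the guarantee.  NOT CLAIMED: any `M` for a concrete
proposal; optimal constants; unbounded observables; `M = 0` (then `K` draws independently from `π`).
-/

noncomputable section

namespace Summit.Ventures.LatticeQCDFlow.Scoring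

open MeasureTheory ProbabilityTheory Filter Finset Summit.Ventures.LatticeQCDFlow.Exactness
open scoped ENNReal

variable {Ω : Type*} [MeasurableSpace Ω]

/-- **COLD START: an independence Metropolis run with log-density-ratio oscillation `≤ M` certifies
its own median-of-blocks error bar at regeneration rate `e^{−M}`.**  See the module docstring. -/
theorem indepMH_medianOfBlocks {π q : Measure Ω} [IsProbabilityMeasure π] [IsProbabilityMeasure q]
    {ρ : Ω → ℝ} (hρm : Measurable ρ) (hρ0 : ∀ x, 0 < ρ x)
    (hq : q = π.withDensity fun x => ENNReal.ofReal (ρ x)) {M : ℝ} (hM0 : 0 < M)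
    (hM : ∀ x y, ρ x ≤ Real.exp M * ρ y)
    {f : Ω → ℝ} (hf : Measurable f) {C : ℝ} (hC : ∀ x, |f x| ≤ C) {N : ℕ} (hN : N ≠ 0) (g R : ℕ)
    {s : ℝ} (hs : 0 < s)
    (hsmall : 4 * ((2 / Real.exp (-M) - 1) * (∫ z, (f z - ∫ y, f y ∂π) ^ 2 ∂π) / N
      + 16 * (C + |∫ z, f z ∂π|) ^ 2 / (Real.exp (-M) ^ 2 * (N : ℝ) ^ 2)) ≤ s ^ 2)
    (μ₀ : Measure Ω) [IsProbabilityMeasure μ₀] :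
    haveI : Fact (Measurable fun x => (ρ x)⁻¹) := ⟨hρm.inv⟩
    (Kernel.trajMeasure (X := fun _ : ℕ => Ω) μ₀
        (fun n : ℕ => (indepMH q fun x => (ρ x)⁻¹).comap
          (fun h : (i : ↥(Finset.Iic n)) → Ω => h ⟨n, Finset.mem_Iic.2 le_rfl⟩)
          (measurable_pi_apply _))).real
        {y | (R : ℝ) / 2 ≤ ∑ j ∈ Finset.range R,
          (if s ≤ |(∑ i ∈ Finset.range N, f (y (j * (N + g) + i))) / N - ∫ z, f z ∂π|
            then (1 : ℝ) else 0)}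
      ≤ ((R - 1 : ℕ) : ℝ) * (1 - Real.exp (-M)) ^ g + Real.exp (-((R : ℝ) / 8)) := by
  haveI : Fact (Measurable fun x => (ρ x)⁻¹) := ⟨hρm.inv⟩
  obtain ⟨hinv, -, hdoeb⟩ := indepMH_exact_doeblin_of_density_ratio hρm hρ0 hq hM
  have hε0 : 0 < ENNReal.ofReal (Real.exp (-M)) := ENNReal.ofReal_pos.2 (Real.exp_pos _)
  have hε1 : ENNReal.ofReal (Real.exp (-M)) < 1 := by
    rw [ENNReal.ofReal_lt_one]
    exact Real.exp_lt_one_iff.2 (by linarith)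
  have hr : (ENNReal.ofReal (Real.exp (-M))).toReal = Real.exp (-M) :=
    ENNReal.toReal_ofReal (Real.exp_pos _).le
  have h := chain_medianOfBlocks_confidence_of_doeblin (κ := indepMH q fun x => (ρ x)⁻¹) hinv
    (fun x B hB => hdoeb x hB) hε0 hε1 hf hC hN g R hs (by rw [hr]; exact hsmall) μ₀
  rw [hr] at h
  exact h

/-- **WARM START: the same sampler started in `π` — a variance-driven radius.**  See the module
docstring. -/
theorem indepMH_medianOfBlocks_warm {π q : Measure Ω} [IsProbabilityMeasure π]
    [IsProbabilityMeasure q] {ρ : Ω → ℝ} (hρm : Measurable ρ) (hρ0 : ∀ x, 0 < ρ x)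
    (hq : q = π.withDensity fun x => ENNReal.ofReal (ρ x)) {M : ℝ} (hM0 : 0 < M)
    (hM : ∀ x y, ρ x ≤ Real.exp M * ρ y)
    {f : Ω → ℝ} (hf : Measurable f) {C : ℝ} (hC : ∀ x, |f x| ≤ C) {N : ℕ} (hN : N ≠ 0) (g R : ℕ)
    {s : ℝ} (hs : 0 < s)
    (hsmall : 4 * ((2 / Real.exp (-M) - 1) * (∫ z, (f z - ∫ y, f y ∂π) ^ 2 ∂π) / N) ≤ s ^ 2) :
    haveI : Fact (Measurable fun x => (ρ x)⁻¹) := ⟨hρm.inv⟩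
    (Kernel.trajMeasure (X := fun _ : ℕ => Ω) π
        (fun n : ℕ => (indepMH q fun x => (ρ x)⁻¹).comap
          (fun h : (i : ↥(Finset.Iic n)) → Ω => h ⟨n, Finset.mem_Iic.2 le_rfl⟩)
          (measurable_pi_apply _))).real
        {y | (R : ℝ) / 2 ≤ ∑ j ∈ Finset.range R,
          (if s ≤ |(∑ i ∈ Finset.range N, f (y (j * (N + g) + i))) / N - ∫ z, f z ∂π|
            then (1 : ℝ) else 0)}
      ≤ ((R - 1 : ℕ) : ℝ) * (1 - Real.exp (-M)) ^ g + Real.exp (-((R : ℝ) / 8)) := by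
  haveI : Fact (Measurable fun x => (ρ x)⁻¹) := ⟨hρm.inv⟩
  obtain ⟨hinv, -, hdoeb⟩ := indepMH_exact_doeblin_of_density_ratio hρm hρ0 hq hM
  have hε0 : 0 < ENNReal.ofReal (Real.exp (-M)) := ENNReal.ofReal_pos.2 (Real.exp_pos _)
  have hε1 : ENNReal.ofReal (Real.exp (-M)) < 1 := by
    rw [ENNReal.ofReal_lt_one]
    exact Real.exp_lt_one_iff.2 (by linarith)
  have hr : (ENNReal.ofReal (Real.exp (-M))).toReal = Real.exp (-M) :=
    ENNReal.toReal_ofReal (Real.exp_pos _).le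
  have h := chain_medianOfBlocks_confidence_warm (κ := indepMH q fun x => (ρ x)⁻¹) hinv
    (fun x B hB => hdoeb x hB) hε0 hε1 hf hC hN g R hs (by rw [hr]; exact hsmall)
  rw [hr] at h
  exact h

end Summit.Ventures.LatticeQCDFlow.Scoring

end
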